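import Mathlib
import HarnessLib
import HarnessLib.Audit
import Summits.AtomisticToContinuum.Statement
import Literature.MathematicalPhysics.QuantumManyBody.BoseGasFreeDirichletBEC
import Literature.MathematicalPhysics.QuantumManyBody.BoseEinsteinCondensation
import Literature.MathematicalPhysics.QuantumManyBody.BoseGasDirichletWall
import HarnessLib.Audit.Status.Attr

/-!
Route: HealingPivotCascade

# Route HealingPivotCascade — Healing-pivot cascade — bank the proved healing-scale floor; BEC ⟸
dimension-free per-step retention cap (positivity) ∧ two-sided geometric domination of the relative
coherent-sum loss (residual)

decomp-a2c NODE N_B.B «HealingPivotCascade» (lens 6 «barrier-complement carving», gen 9; conjunct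
BoseEinsteinCondensation; an OR-SIBLING at the ROOT of the conjunct, not a refinement of the
CondensateScaleLadder → CoherentDoubling → ScaleConvexity → CondensedPivot lineage — kernel link
`node_of_condensedPivot`: that lineage's assembly hypotheses imply both new cruxes). OBJECT: the
dyadic COHERENT SUM S_k(Ψ) := Σ over the 8^k grid sub-cells q of side L_N/2^k of the occupation
⟨u_q, γ_Ψ u_q⟩ of the normalised indicator mode u_q (nondecreasing in k, ≤ N, S_0 ≤ λ_max).
RE-ROOTING: the Literature FLOOR at the HEALING PIVOT is a PROVED tree theorem —
`BoseGas.floor_of_scatteringLength_pos` / `…_zero`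
(Literature/…/BoseGasSubcellCondensationDilute.lean: for every admissible v and M > 0, all small ρ,
eventually in N, every 1-near-minimiser has S_K ≥ 7N/8 at the pivot level M/√ρ ≤ L_N/2^K < 2M/√ρ;
sharp form `floor_of_scatteringLength_pos_sharp`: ≥ (1−η)N); the module has no hub olean since the
2026-08-25 rebuild, so the floor is banked as the support item DiluteFloor (its conclusion verbatim,
discharge a two-line `exact`). Modulo that theorem the conjunct says exactly that the coherent sum
is not consumed between the healing pivot and the box. It suffices to show X = RetentionCap ∧
InfraredDomination: for every admissible v and all small ρ, eventually in N at some tolerance δ_N,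
every δ_N-near-minimiser Ψ either has λ_max(γ_Ψ) ≥ c₀N outright, or (RetentionCap, attacked,
dimension-free) one coarsening never loses more than a fixed fraction x̄ < 1 of the coherent sum on
levels with S_k ≥ θN, and (InfraredDomination, declared residual) the RELATIVE loss per coarsening
is geometrically dominated from BOTH ends, S_k ≤ S_(k−1) + A(q^(K−k) + q^k)·S_k for 1 ≤ k ≤ K — at
scale ℓ the majorant is A[(ℓ_K/ℓ)^α + (ℓ/L)^α]: infrared depletion from the healing side,
macroscopic-mode curvature from the box side (a pure Dirichlet condensate ∏ sin(πx_i/L) alone loses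
the fractions 0, 0.378, 0.110, 0.028 ≍ 4^(−k) at k = 1…4, so the box-side term is forced; Bogoliubov
theory predicts q = 1/4 on both sides). Kernel facts (node file NodeHealingPivotCascade.lean, 0
sorry, axioms propext / Classical.choice / Quot.sound): CascadeEngine PROVED (floor + cap +
two-sided domination at one density ⇒ HasGroundStateBEC: the ≤ 2i₀ levels within i₀ of either end
take cap steps, the middle spends a budget ≤ 1/2, S_0 ≥ (7/16)(1−x̄)^(2i₀)N ≤ λ_max); both cruxes
NECESSARY unconditionally (escape disjunct); EXACTNESS DiluteFloor → (BoseEinsteinCondensation ↔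
RetentionCap ∧ InfraredDomination); BC5 rung `dominationLaw_nearPivot`: from the sharp floor the
domination law at any fixed number of levels above the pivot, any slope, every 1-near-minimiser, no
escape.
Lean: `Summit.AtomisticToContinuum.BoseEinsteinCondensation.Theses.HealingPivotCascade.RetentionCap
∧
Summit.AtomisticToContinuum.BoseEinsteinCondensation.Theses.HealingPivotCascade.InfraredDomination`

## Assembly
Pure logic plus the kernel-proved engine: for an admissible v take ρ₀ := min of the thresholds of
DiluteFloor (at M = 1), RetentionCap and InfraredDomination; for 0 < ρ < ρ₀ feed the three eventual
statements to CascadeEngine at (v, ρ). The deciding theorem `closes (h₀ : DiluteFloor) (h₁ :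
RetentionCap) (h₂ : InfraredDomination) (h₃ : CascadeEngine) : BoseEinsteinCondensation` is
glue.lean (eleven lines); in the node file `closes_kernel` discharges h₃ by `cascadeEngine_holds`,
and h₀ is a proved Literature theorem verbatim, so the conjunct is decided by RetentionCap ∧
InfraredDomination (conjunct split: RetentionCap attacked, InfraredDomination declared residual;
`bec_iff_node` certifies the split is exact).

Rationale: WHY THIS LINE. Every existing BEC route types either local condensation at a scale
(CondensateScaleLadder, BECHierarchicalRetention, the LSSY/Fournais energy-localisation ladder
[LSSY2005, Fournais2020, Junge2026]), a profile-SHAPE law for the max-over-cubes coherent fraction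
(ScaleConvexity, CondensedPivot), or a positivity / variance / gap functional at the summit level;
none banks the healing-pivot floor — which is now a theorem in the tree at exactly the scale where
energy localisation provably stops in the thermodynamic limit ([Fournais2020] p. 4: «this technique
does not work in the thermodynamic limit»; [Junge2026] Cor. 6: condensation on scales
(ρa)^(−1/2)(ρa³)^(−η)) — and asks what is left. What is left is a LOSS BUDGET for the coherent SUM
across the ~(1/3)log₂N coarsenings between the pivot and the box, and it carves along the barrier
line into (i) a dimension-free CAP per step, whose mechanism is POSITIVITY, imported from the
functional-integral side (Perron–Frobenius / Feynman–Kac uniqueness and positivity of the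
finite-volume ground state [GlimmJaffeQP1987 §3.3], the tree's
`GroundStateFeynmanKacPerronFrobenius` and the rigidity item stmt-AtomisticToContinuum-9072): for a
nonnegative kernel γ_Ψ₀ the parent indicator mode u_p = 8^(−1/2)Σ u_q has ⟨u_p, γ u_p⟩ ≥ (1/8)Σ⟨u_q,
γ u_q⟩ with no energy input, and δ_N-near-minimisers (δ chosen after N, below the finite-volume gap)
inherit it by the trace-norm Lipschitz bound — true verbatim for the 1D Tonks gas [Lenard1964,
ForresterEtAl2003] where BEC fails, so it is a genuine complement; and (ii) the d ≥ 2 content as ONE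
typed, kernel-necessary, falsifiable law with a free exponent — the two-sided geometric domination
that Bogoliubov theory [LiebSeiringer2002, BoccatoEtAl2019Acta] predicts with q = 1/4 and whose
verbatim d = 1 analogue is false (constant relative loss 1 − 2^(−1/2) per coarsening [Haldane1981,
Cazalilla2004]) — exactly where HohenbergLowDimension / PitaevskiiStringariOneDimension say the
dimension must enter. The cascade engine that glues floor, cap and law is elementary real analysis
and is kernel-proved; the rung (law at every FIXED depth above the pivot, from the sharp floor) is
kernel-proved modulo the unbuilt Literature module, so the residual is an honest «every fixed depth
a theorem, depth K(N) → ∞ open» ladder rather than a restatement.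

RANKED CRUXES. #2 InfraredDomination (crux) — piece A (declared RESIDUAL of record for this sibling;
the d ≥ 2 content). For every repulsive finite-range v there is ρ₀ > 0 such that for all 0 < ρ < ρ₀
there are A > 0, 0 < q < 1, c₀ > 0 with: eventually in N, for some δ > 0, every δ-near-minimiser Ψ
in the Dirichlet box of side L_N = (N/ρ)^(1/3) satisfies ofReal(c₀N) ≤ λ_max(γ_Ψ) OR, for every
pivot level K (1/√ρ ≤ L_N/2^K < 2/√ρ) and every 1 ≤ k ≤ K, S_k ≤ S_(k−1) + ofReal(A·(q^(K−k) +
q^k))·S_k, where S_k = Σ_(q ∈ SubIdx(2^k)) occupation of the sub-cell mode subMode(L_N/2^k) q («the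
relative coherent-sum loss per coarsening is geometrically dominated from the healing pivot AND from
the box»). [difficulty: open-problem] (why it might fail: in d = 3 the relative loss at intermediate
scales ξ ≪ ℓ ≪ L may decay slower than any geometric rate (e.g. like 1/(K−k), non-summable,
quasi-condensate-type drift) although λ_max is macroscopic only marginally; the verbatim d = 1
analogue IS false (Tonks: constant 0.293), d = 2 is marginal.) [LiebSeiringer2002,
BoccatoEtAl2019Acta, Fournais2020, Junge2026, Haldane1981, Cazalilla2004, LSSY2005]
#3 RetentionCap (crux) — piece B (ATTACKED; dimension-free complement). For every repulsive
finite-range v there is ρ₀ > 0 such that for all 0 < ρ < ρ₀ there are 0 < x̄ < 1 and c₀ > 0 such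
that for every θ > 0: eventually in N, for some δ > 0, every δ-near-minimiser Ψ satisfies
ofReal(c₀N) ≤ λ_max(γ_Ψ) OR, for every k ≥ 1 with ofReal(θN) ≤ S_k, ofReal(1 − x̄)·S_k ≤ S_(k−1)
(«one coarsening never loses more than the fraction x̄ of the coherent sum»; kinematic with x̄ = 7/8
for an entrywise nonnegative γ, transported to δ_N-near-minimisers of the positive Perron–Frobenius
ground state by the finite-volume gap and the trace-norm Lipschitz bound |S_k(Ψ) − S_k(Ψ₀)| ≤ 2N‖Ψ −
Ψ₀‖). [difficulty: M] (why it might fail: needs a UNIQUE, attained, positive ground state in the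
TrialState frame at each large N (hard-core v may disconnect configuration space or the
Dirichlet-form minimiser may fail to be a TrialState); a degenerate ground space with a
sign-structured member breaks the transport step.) [GlimmJaffeQP1987, ReedSimon1972, Lenard1964,
ForresterEtAl2003, PenroseOnsager1956]
#9 DiluteFloor (support) — the DILUTE HEALING FLOOR, verbatim common conclusion (for every M > 0) of
the PROVED tree theorems `BoseGas.floor_of_scatteringLength_pos` /
`BoseGas.floor_of_scatteringLength_zero`
(Literature/MathematicalPhysics/QuantumManyBody/BoseGasSubcellCondensationDilute.lean): for every
admissible v and M > 0 there is ρ₀ > 0 such that for 0 < ρ < ρ₀, eventually in N, every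
1-near-minimiser has S_k ≥ 7N/8 at every level k with M/√ρ ≤ L_N/2^k < 2M/√ρ. Discharge: `fun v hv M
hM => (eq_zero_or_pos _).elim (fun h0 => floor_of_scatteringLength_zero hv h0 hM) (fun hp =>
floor_of_scatteringLength_pos hv hp hM)` once the module has a hub olean (identical to writer-1's
DiluteFloor for HealingScaleCondensate stmt-AtomisticToContinuum-26085). [difficulty: provable-now]
[LSSY2005, LiebSeiringer2002, FournaisSolovej2020]
#9 CascadeEngine (support) — the CASCADE ENGINE at one density (KERNEL-PROVED in the node file,
`cascadeEngine_holds`): for every v and ρ > 0, the floor at the healing pivot (M = 1, as in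
DiluteFloor), the retention cap at ρ and the two-sided domination law at ρ together imply
HasGroundStateBEC v ρ (abstract real cascade: levels within i₀ of either end take cap steps, the
middle spends the budget A·Σ(q^(K−k) + q^k) ≤ 2Aq^(i₀)/(1−q) ≤ 1/2 where Aq^(i₀) ≤ (1−q)/4; S_0 ≥
(7/16)(1−x̄)^(2i₀)·N; the level-0 sub-cell mode is a test mode for λ_max; le_condensateNumber with δ
:= min δ_cap δ_dom 1). [difficulty: provable-now] [LSSY2005]

TWO-LAYER PLAN. Foreseen once RetentionCap closes: InfraredDomination ⇐ DepthDomination(m) →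
TailDomination → InfraredDomination, where DepthDomination(m(N)) pushes the kernel rung from fixed
depth m to a divergent depth m(N) → ∞ above the pivot (energy localisation with LHY precision on
boxes (ρa)^(−1/2)(ρa³)^(−1/4−η), [Fournais2020] p. 4) and TailDomination is the law on the remaining
top levels (macroscopic-mode curvature side); k ≤ 3, depth 1. Nothing filed now.

KILL CRITERIA. A refutation of InfraredDomination AS TYPED (a family of admissible v, ρ → 0, and
near-minimisers without macroscopic occupation whose relative loss violates every two-sided
geometric majorant) closes the route `refuted:InfraredDomination` unless the witness is
summable-but-not-geometric (then pivot: restate with a summable majorant Σ_k x_k ≤ B, which the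
engine also supports). A refutation of RetentionCap (degenerate or sign-structured finite-volume
ground states for admissible hard-core v) forces a pivot to the |Ψ|-symmetrised cap (cap for the
positive representative only, with the engine run on |Ψ|). BEC proved elsewhere moots the route
(both cruxes follow by necessity); a proof that the loss law is equivalent to BEC with no
intermediate depth gain would retire it as not-a-thesis.

NOT DECOMPOSED YET. The depth ladder of InfraredDomination (fixed m is the rung; m(N) → ∞ is the
first real step; the box-side tail is separate), the constants A, q (Bogoliubov predicts q = 1/4;
any q < 1 suffices), and the TrialState-frame facts RetentionCap needs
(existence/uniqueness/positivity of the finite-volume minimiser, trace-norm Lipschitz of S_k) are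
deliberately layer-2: provers attach them with --supports.

CHEAPEST FALSIFIER. Bogoliubov quadrature of the relative flat-mode loss per dyadic coarsening x(ℓ)
= 1 − S(2ℓ)/S(ℓ) in d = 3 (prediction x ≍ √(ρa³)(ξ/ℓ)² + c(ℓ/L)², ratio → 1/4 from each end) — if
the Bogoliubov ground state itself showed a non-geometric intermediate regime the residual would be
dead as typed; and the exact 1D Tonks–Girardeau check (Lenard: λ₀ ≈ C√N ⇒ constant x = 1 − 2^(−1/2)
≈ 0.293 — confirms RetentionCap's analogue with any x̄ > 0.293 and kills InfraredDomination's
analogue, the intended separation). Filed as instrument ask I-IRD-Bog on the cell INBOX (no kit in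
this seat). In-Lean: the curvature numbers p_k = 0.8106, 0.8106, 0.9496, 0.9872, 0.9968 for the
Dirichlet mode were computed (python) and forced the two-sided form before filing.

NUMBERS. Floor 7/8 at the pivot M/√ρ ≤ ℓ < 2M/√ρ (tree theorems; sharp form 1 − η); healing length ξ
= (8πρa)^(−1/2); LHY parameter √(ρa³); Bogoliubov depletion relative loss ≍ √(ρa³)(ξ/ℓ)² (q = 1/4);
Dirichlet-mode curvature losses 0, 0.378, 0.110, 0.028, 0.007 at k = 1…5 (q = 1/4 from the box);
Tonks gas λ₀(N) ~ √N, relative loss 1 − 2^(−1/2) per coarsening [Lenard1964, ForresterEtAl2003];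
energy-localisation reach (ρa)^(−1/2)(ρa³)^(−η), improvable to (ρa³)^(−1/4−η) with LHY precision
[Fournais2020 p. 4, Junge2026 Cor. 6]; engine constant S_0 ≥ (7/16)(1 − x̄)^(2i₀)N with A q^(i₀) ≤
(1 − q)/4.

DEFINITION REQUESTS. None: S_k is spelled out with the existing `BoseGas.subMode` /
`BoseGas.occupation` / `BoseGas.SubIdx`; the floor theorems exist (module
BoseGasSubcellCondensationDilute needs a hub build, flagged to the operator on the cell INBOX).

Novelty: Searches (2026-08-30): lit search --hybrid «length scales BEC dilute Bose gas thermodynamic limit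
localization» (Fournais2020 p. 3–4, Junge2026 p. 6 read); lit search --hybrid «Perron-Frobenius
positivity ground state unique Schrödinger Feynman-Kac» (6 book hits: chung1995 p. 221, glimm1987 p.
22/52, gustafson2003 p. 133); lit search --hybrid «Tonks-Girardeau one-body density matrix largest
eigenvalue sqrt N Lenard» (no relevant corpus hit; tree barrier OneDimensionalHardCoreODLRO holds
Lenard's asymptotics); lit galaxy search «length scales for BEC|condensate depletion» --star all (1
+ 3 pdf hits, none on a scale-indexed loss law); ledger negatives AtomisticToContinuum (25 entries,
none a coherent-sum loss statement); lean search «cohSum|subMode|floor_of_scatteringLength» (tree: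
DyadicCoherentFraction*, BoseGasSubcellCondensation*, BECHierarchicalRetention.GeometricRetention).
Nearest prior art found: route-AtomisticToContinuum-BECHierarchicalRetention item GeometricRetention
stmt-AtomisticToContinuum-14782 (dormant; an ABSOLUTE 1/s retention law for Ioo-cube indicator modes
anchored at the interparticle scale ρ^(−1/3), one-sided, not necessary for BEC) and
CondensedPivot.PivotNonSteepening stmt-31173 (shape monotonicity of the max-over-cubes fraction); in
print, the energy-localisation ladder [LSSY2005 Thm 7.1 scheme, Fournais2020, Junge2026] proves
condensation on N-independent multiples of the healing length and states no loss law across scales.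
Delta: the first route on  [refs: Fournais2020, Junge2026, LSSY2005]

Barriers (technique_class: residual-carving, multiscale, loss-budget, positivity): - technique_class: residual-carving, multiscale, loss-budget, positivity
- Literature.Barriers.AtomisticToContinuum.KineticGapLengthScales: (with
KineticGapLengthScalesNarrow / …ThermodynamicWindow / …ModeFree) the class «kinetic gap of a box of
side ℓ below the interaction window ⇒ condensation on scale ℓ» stops at N-independent multiples of
the healing length ([corpus:paper:arxiv-2011.00309 p. 4] «does not work in the thermodynamic
limit»): DiluteFloor and the RUNG sit exactly at that ceiling and claim no more; InfraredDomination
at ALL depths is declared residual and is NOT claimed provable by the gap method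
(requires-beating-barrier ⇒ residual); RetentionCap uses no gap-vs-window comparison at all
(positivity), outside the class.
- Literature.Barriers.AtomisticToContinuum.KineticGapLengthScalesNarrow: every piece keeps «∃ δ
after N» (no energy window w_N), so `exists_decondensed_within_gap` /
`energyWindow_fraction_le_half` do not quantify over them; at v = 0 both cruxes hold via the escape
(free Dirichlet BEC is a tree theorem).
- Literature.Barriers.AtomisticToContinuum.BogoliubovPerturbationInfrared: bites any proof of
InfraredDomination by expansion about a c-number condensate in the thermodynamic box (Popov1983
infrared divergence); the law is only PREDICTED by Bogoliubov (q = 1/4), not claimed provable by it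
— declared residual; RetentionCap and the engine use no expansion.
- Literature.Barriers.AtomisticToContinuum.HohenbergLowDimension: (with HohenbergLowDimension

sub-problem: BoseEinsteinCondensation · status: draft · opened planner-decomp-a2c-lens-6-g9-0 2026-08-30T10:14:17Z · rev 0 · ledger route-AtomisticToContinuum-HealingPivotCascade
GENERATED by the gate from the ledger (D-0016/17). Provers cite these decls: `theorem foo : Summit.AtomisticToContinuum.BoseEinsteinCondensation.Theses.HealingPivotCascade.<Decl> := …` in Summits/AtomisticToContinuum/BoseEinsteinCondensation/Theorems/<Name>.lean.
-/

namespace Summit.AtomisticToContinuum.BoseEinsteinCondensation.Theses.HealingPivotCascade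

open scoped BigOperators Topology Manifold Classical MeasureTheory ProbabilityTheory Matrix InnerProductSpace ComplexConjugate ContinuousMap
open Filter Set Function TopologicalSpace MeasureTheory

attribute [summit_statement] _root_.BoseEinsteinCondensation

/-- item stmt-AtomisticToContinuum-32058 · crux · rank 2 · open · by planner
why it might fail: in d = 3 the relative loss at intermediate scales ξ ≪ ℓ ≪ L may decay slower than any geometric rate (e.g. like 1/(K−k), non-summable, quasi-condensate-type drift) although λ_max is macroscopic only marginally; the verbatim d = 1 analogue IS false (Tonks: constant 0.293), d = 2 is marginal.
sources: LiebSeiringer2002, BoccatoEtAl2019Acta, Fournais2020, Junge2026, Haldane1981, Cazalilla2004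
[crux] piece A (declared RESIDUAL of record for this sibling; the d ≥ 2 content). For every
repulsive finite-range v there is ρ₀ > 0 such that for all 0 < ρ < ρ₀ there are A > 0, 0 < q < 1, c₀
> 0 with: eventually in N, for some δ > 0, every δ-near-minimiser Ψ in the Dirichlet box of side L_N
= (N/ρ)^(1/3) satisfies ofReal(c₀N) ≤ λ_max(γ_Ψ) OR, for every pivot level K (1/√ρ ≤ L_N/2^K < 2/√ρ)
and every 1 ≤ k ≤ K, S_k ≤ S_(k−1) + ofReal(A·(q^(K−k) + q^k))·S_k, where S_k = Σ_(q ∈ SubIdx(2^k))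
occupation of the sub-cell mode subMode(L_N/2^k) q («the relative coherent-sum loss per coarsening
is geometrically dominated from the healing pivot AND from the box»). [difficulty: open-problem] -/
@[route_item "route-AtomisticToContinuum-HealingPivotCascade", crux]
def InfraredDomination : Prop :=
  ∀ v : ℝ → ENNReal, Literature.MathematicalPhysics.QuantumManyBody.BoseGas.IsRepulsiveFiniteRange v → ∃ ρ₀ : ℝ, 0 < ρ₀ ∧ ∀ ρ : ℝ, 0 < ρ → ρ < ρ₀ → ∃ A : ℝ, 0 < A ∧ ∃ q : ℝ, 0 < q ∧ q < 1 ∧ ∃ c₀ : ℝ, 0 < c₀ ∧ ∀ᶠ N : ℕ in Filter.atTop, ∃ δ : ENNReal, 0 < δ ∧ ∀ Ψ : Literature.MathematicalPhysics.QuantumManyBody.BoseGas.TrialState N (Literature.MathematicalPhysics.QuantumManyBody.BoseGas.sideLength ρ N), Literature.MathematicalPhysics.QuantumManyBody.BoseGas.energy v Ψ ≤ Literature.MathematicalPhysics.QuantumManyBody.BoseGas.groundStateEnergy v N (Literature.MathematicalPhysics.QuantumManyBody.BoseGas.sideLength ρ N) + δ → ENNReal.ofReal (c₀ * N) ≤ Literature.MathematicalPhysics.QuantumManyBody.BoseGas.maxOccupation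 N Ψ.ψ ∨ ∀ K k : ℕ, 1 / Real.sqrt ρ ≤ Literature.MathematicalPhysics.QuantumManyBody.BoseGas.sideLength ρ N / 2 ^ K → Literature.MathematicalPhysics.QuantumManyBody.BoseGas.sideLength ρ N / 2 ^ K < 2 * (1 / Real.sqrt ρ) → 1 ≤ k → k ≤ K → ∑ q' : Literature.MathematicalPhysics.QuantumManyBody.BoseGas.SubIdx (2 ^ k), Literature.MathematicalPhysics.QuantumManyBody.BoseGas.occupation N (Literature.MathematicalPhysics.QuantumManyBody.BoseGas.subMode (Literature.MathematicalPhysics.QuantumManyBody.BoseGas.sideLength ρ N / 2 ^ k) q') Ψ.ψ ≤ (∑ q' : Literature.MathematicalPhysics.QuantumManyBody.BoseGas.SubIdx (2 ^ (k - 1)), Literature.MathematicalPhysics.QuantumManyBody.BoseGas.occupation N (Literature.MathematicalPhysics.QuantumManyBody.BoseGas.subMode (Literature.MathematicalPhysics.QuantumManyBody.BoseGas.sideLength ρ N / 2 ^ (k - 1)) q') Ψ.ψ) + ENNReal.ofReal (A * (q ^ (K - k) + q ^ k)) * ∑ q' : Literature.MathematicalPhysics.QuantumManyBody.BoseGas.SubIdx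 (2 ^ k), Literature.MathematicalPhysics.QuantumManyBody.BoseGas.occupation N (Literature.MathematicalPhysics.QuantumManyBody.BoseGas.subMode (Literature.MathematicalPhysics.QuantumManyBody.BoseGas.sideLength ρ N / 2 ^ k) q') Ψ.ψ

/-- item stmt-AtomisticToContinuum-32059 · crux · rank 3 · open · by planner
why it might fail: needs a UNIQUE, attained, positive ground state in the TrialState frame at each large N (hard-core v may disconnect configuration space or the Dirichlet-form minimiser may fail to be a TrialState); a degenerate ground space with a sign-structured member breaks the transport step.
sources: GlimmJaffeQP1987, ReedSimon1972, Lenard1964, ForresterEtAl2003, PenroseOnsager1956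
[crux] piece B (ATTACKED; dimension-free complement). For every repulsive finite-range v there is ρ₀
> 0 such that for all 0 < ρ < ρ₀ there are 0 < x̄ < 1 and c₀ > 0 such that for every θ > 0:
eventually in N, for some δ > 0, every δ-near-minimiser Ψ satisfies ofReal(c₀N) ≤ λ_max(γ_Ψ) OR, for
every k ≥ 1 with ofReal(θN) ≤ S_k, ofReal(1 − x̄)·S_k ≤ S_(k−1) («one coarsening never loses more
than the fraction x̄ of the coherent sum»; kinematic with x̄ = 7/8 for an entrywise nonnegative γ,
transported to δ_N-near-minimisers of the positive Perron–Frobenius ground state by the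
finite-volume gap and the trace-norm Lipschitz bound |S_k(Ψ) − S_k(Ψ₀)| ≤ 2N‖Ψ − Ψ₀‖). [difficulty:
M] -/
@[route_item "route-AtomisticToContinuum-HealingPivotCascade", crux]
def RetentionCap : Prop :=
  ∀ v : ℝ → ENNReal, Literature.MathematicalPhysics.QuantumManyBody.BoseGas.IsRepulsiveFiniteRange v → ∃ ρ₀ : ℝ, 0 < ρ₀ ∧ ∀ ρ : ℝ, 0 < ρ → ρ < ρ₀ → ∃ x : ℝ, 0 < x ∧ x < 1 ∧ ∃ c₀ : ℝ, 0 < c₀ ∧ ∀ θ : ℝ, 0 < θ → ∀ᶠ N : ℕ in Filter.atTop, ∃ δ : ENNReal, 0 < δ ∧ ∀ Ψ : Literature.MathematicalPhysics.QuantumManyBody.BoseGas.TrialState N (Literature.MathematicalPhysics.QuantumManyBody.BoseGas.sideLength ρ N), Literature.MathematicalPhysics.QuantumManyBody.BoseGas.energy v Ψ ≤ Literature.MathematicalPhysics.QuantumManyBody.BoseGas.groundStateEnergy v N (Literature.MathematicalPhysics.QuantumManyBody.BoseGas.sideLength ρ N) + δ → ENNReal.ofReal (c₀ * N) ≤ Literature.MathematicalPhysics.QuantumManyBody.BoseGas.maxOccupation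 N Ψ.ψ ∨ ∀ k : ℕ, 1 ≤ k → ENNReal.ofReal (θ * N) ≤ ∑ q : Literature.MathematicalPhysics.QuantumManyBody.BoseGas.SubIdx (2 ^ k), Literature.MathematicalPhysics.QuantumManyBody.BoseGas.occupation N (Literature.MathematicalPhysics.QuantumManyBody.BoseGas.subMode (Literature.MathematicalPhysics.QuantumManyBody.BoseGas.sideLength ρ N / 2 ^ k) q) Ψ.ψ → ENNReal.ofReal (1 - x) * ∑ q : Literature.MathematicalPhysics.QuantumManyBody.BoseGas.SubIdx (2 ^ k), Literature.MathematicalPhysics.QuantumManyBody.BoseGas.occupation N (Literature.MathematicalPhysics.QuantumManyBody.BoseGas.subMode (Literature.MathematicalPhysics.QuantumManyBody.BoseGas.sideLength ρ N / 2 ^ k) q) Ψ.ψ ≤ ∑ q : Literature.MathematicalPhysics.QuantumManyBody.BoseGas.SubIdx (2 ^ (k - 1)), Literature.MathematicalPhysics.QuantumManyBody.BoseGas.occupation N (Literature.MathematicalPhysics.QuantumManyBody.BoseGas.subMode (Literature.MathematicalPhysics.QuantumManyBody.BoseGas.sideLength ρ N / 2 ^ (k - 1)) q) Ψ.ψ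

/-- item stmt-AtomisticToContinuum-32060 · support · rank 9 · closed · proved by Summit.AtomisticToContinuum.BoseEinsteinCondensation.Theses.GapWindowLadder.diluteFloor_proof (prover) · by planner
sources: LSSY2005, LiebSeiringer2002, FournaisSolovej2020
[support] the DILUTE HEALING FLOOR, verbatim common conclusion (for every M > 0) of the PROVED tree
theorems `BoseGas.floor_of_scatteringLength_pos` / `BoseGas.floor_of_scatteringLength_zero`
(Literature/MathematicalPhysics/QuantumManyBody/BoseGasSubcellCondensationDilute.lean): for every
admissible v and M > 0 there is ρ₀ > 0 such that for 0 < ρ < ρ₀, eventually in N, every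
1-near-minimiser has S_k ≥ 7N/8 at every level k with M/√ρ ≤ L_N/2^k < 2M/√ρ. Discharge: `fun v hv M
hM => (eq_zero_or_pos _).elim (fun h0 => floor_of_scatteringLength_zero hv h0 hM) (fun hp =>
floor_of_scatteringLength_pos hv hp hM)` once the module has a hub olean (identical to writer-1's
DiluteFloor for HealingScaleCondensate stmt-AtomisticToContinuum-26085). [difficulty: provable-now] -/
@[route_item "route-AtomisticToContinuum-HealingPivotCascade", crux]
def DiluteFloor : Prop :=
  ∀ v : ℝ → ENNReal, Literature.MathematicalPhysics.QuantumManyBody.BoseGas.IsRepulsiveFiniteRange v → ∀ M : ℝ, 0 < M → ∃ ρ₀ : ℝ, 0 < ρ₀ ∧ ∀ ρ : ℝ, 0 < ρ → ρ < ρ₀ → ∀ᶠ N : ℕ in Filter.atTop, ∀ Ψ : Literature.MathematicalPhysics.QuantumManyBody.BoseGas.TrialState N (Literature.MathematicalPhysics.QuantumManyBody.BoseGas.sideLength ρ N), Literature.MathematicalPhysics.QuantumManyBody.BoseGas.energy v Ψ ≤ Literature.MathematicalPhysics.QuantumManyBody.BoseGas.groundStateEnergy v N (Literature.MathematicalPhysics.QuantumManyBody.BoseGas.sideLength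 ρ N) + 1 → ∀ k : ℕ, M / Real.sqrt ρ ≤ Literature.MathematicalPhysics.QuantumManyBody.BoseGas.sideLength ρ N / 2 ^ k → Literature.MathematicalPhysics.QuantumManyBody.BoseGas.sideLength ρ N / 2 ^ k < 2 * (M / Real.sqrt ρ) → ENNReal.ofReal (7 * (N : ℝ) / 8) ≤ ∑ q : Literature.MathematicalPhysics.QuantumManyBody.BoseGas.SubIdx (2 ^ k), Literature.MathematicalPhysics.QuantumManyBody.BoseGas.occupation N (Literature.MathematicalPhysics.QuantumManyBody.BoseGas.subMode (Literature.MathematicalPhysics.QuantumManyBody.BoseGas.sideLength ρ N / 2 ^ k) q) Ψ.ψ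

-- `DiluteFloor` holds: proved by `Summit.AtomisticToContinuum.BoseEinsteinCondensation.Theses.GapWindowLadder.diluteFloor_proof` (its module imports this route file, so no `_holds` link can be stated here).

/-- item stmt-AtomisticToContinuum-32061 · support · rank 9 · closed · proved by Summit.AtomisticToContinuum.BoseEinsteinCondensation.Theorems.HealingPivotCascadeCascadeEngine.cascadeEngine_holds (prover) · by planner
sources: LSSY2005
[support] the CASCADE ENGINE at one density (KERNEL-PROVED in the node file, `cascadeEngine_holds`):
for every v and ρ > 0, the floor at the healing pivot (M = 1, as in DiluteFloor), the retention cap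
at ρ and the two-sided domination law at ρ together imply HasGroundStateBEC v ρ (abstract real
cascade: levels within i₀ of either end take cap steps, the middle spends the budget A·Σ(q^(K−k) +
q^k) ≤ 2Aq^(i₀)/(1−q) ≤ 1/2 where Aq^(i₀) ≤ (1−q)/4; S_0 ≥ (7/16)(1−x̄)^(2i₀)·N; the level-0
sub-cell mode is a test mode for λ_max; le_condensateNumber with δ := min δ_cap δ_dom 1).
[difficulty: provable-now] -/
@[route_item "route-AtomisticToContinuum-HealingPivotCascade", crux]
def CascadeEngine : Prop :=
  ∀ v : ℝ → ENNReal, ∀ ρ : ℝ, 0 < ρ → (∀ᶠ N : ℕ in Filter.atTop, ∀ Ψ : Literature.MathematicalPhysics.QuantumManyBody.BoseGas.TrialState N (Literature.MathematicalPhysics.QuantumManyBody.BoseGas.sideLength ρ N), Literature.MathematicalPhysics.QuantumManyBody.BoseGas.energy v Ψ ≤ Literature.MathematicalPhysics.QuantumManyBody.BoseGas.groundStateEnergy v N (Literature.MathematicalPhysics.QuantumManyBody.BoseGas.sideLength ρ N) + 1 → ∀ K : ℕ, 1 / Real.sqrt ρ ≤ Literature.MathematicalPhysics.QuantumManyBody.BoseGas.sideLength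 ρ N / 2 ^ K → Literature.MathematicalPhysics.QuantumManyBody.BoseGas.sideLength ρ N / 2 ^ K < 2 * (1 / Real.sqrt ρ) → ENNReal.ofReal (7 * (N : ℝ) / 8) ≤ ∑ q : Literature.MathematicalPhysics.QuantumManyBody.BoseGas.SubIdx (2 ^ K), Literature.MathematicalPhysics.QuantumManyBody.BoseGas.occupation N (Literature.MathematicalPhysics.QuantumManyBody.BoseGas.subMode (Literature.MathematicalPhysics.QuantumManyBody.BoseGas.sideLength ρ N / 2 ^ K) q) Ψ.ψ) → (∃ x : ℝ, 0 < x ∧ x < 1 ∧ ∃ c₀ : ℝ, 0 < c₀ ∧ ∀ θ : ℝ, 0 < θ → ∀ᶠ N : ℕ in Filter.atTop, ∃ δ : ENNReal, 0 < δ ∧ ∀ Ψ : Literature.MathematicalPhysics.QuantumManyBody.BoseGas.TrialState N (Literature.MathematicalPhysics.QuantumManyBody.BoseGas.sideLength ρ N), Literature.MathematicalPhysics.QuantumManyBody.BoseGas.energy v Ψ ≤ Literature.MathematicalPhysics.QuantumManyBody.BoseGas.groundStateEnergy v N (Literature.MathematicalPhysics.QuantumManyBody.BoseGas.sideLength ρ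 N) + δ → ENNReal.ofReal (c₀ * N) ≤ Literature.MathematicalPhysics.QuantumManyBody.BoseGas.maxOccupation N Ψ.ψ ∨ ∀ k : ℕ, 1 ≤ k → ENNReal.ofReal (θ * N) ≤ ∑ q : Literature.MathematicalPhysics.QuantumManyBody.BoseGas.SubIdx (2 ^ k), Literature.MathematicalPhysics.QuantumManyBody.BoseGas.occupation N (Literature.MathematicalPhysics.QuantumManyBody.BoseGas.subMode (Literature.MathematicalPhysics.QuantumManyBody.BoseGas.sideLength ρ N / 2 ^ k) q) Ψ.ψ → ENNReal.ofReal (1 - x) * ∑ q : Literature.MathematicalPhysics.QuantumManyBody.BoseGas.SubIdx (2 ^ k), Literature.MathematicalPhysics.QuantumManyBody.BoseGas.occupation N (Literature.MathematicalPhysics.QuantumManyBody.BoseGas.subMode (Literature.MathematicalPhysics.QuantumManyBody.BoseGas.sideLength ρ N / 2 ^ k) q) Ψ.ψ ≤ ∑ q : Literature.MathematicalPhysics.QuantumManyBody.BoseGas.SubIdx (2 ^ (k - 1)), Literature.MathematicalPhysics.QuantumManyBody.BoseGas.occupation N (Literature.MathematicalPhysics.QuantumManyBody.BoseGas.subMode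 (Literature.MathematicalPhysics.QuantumManyBody.BoseGas.sideLength ρ N / 2 ^ (k - 1)) q) Ψ.ψ) → (∃ A : ℝ, 0 < A ∧ ∃ q : ℝ, 0 < q ∧ q < 1 ∧ ∃ c₀ : ℝ, 0 < c₀ ∧ ∀ᶠ N : ℕ in Filter.atTop, ∃ δ : ENNReal, 0 < δ ∧ ∀ Ψ : Literature.MathematicalPhysics.QuantumManyBody.BoseGas.TrialState N (Literature.MathematicalPhysics.QuantumManyBody.BoseGas.sideLength ρ N), Literature.MathematicalPhysics.QuantumManyBody.BoseGas.energy v Ψ ≤ Literature.MathematicalPhysics.QuantumManyBody.BoseGas.groundStateEnergy v N (Literature.MathematicalPhysics.QuantumManyBody.BoseGas.sideLength ρ N) + δ → ENNReal.ofReal (c₀ * N) ≤ Literature.MathematicalPhysics.QuantumManyBody.BoseGas.maxOccupation N Ψ.ψ ∨ ∀ K k : ℕ, 1 / Real.sqrt ρ ≤ Literature.MathematicalPhysics.QuantumManyBody.BoseGas.sideLength ρ N / 2 ^ K → Literature.MathematicalPhysics.QuantumManyBody.BoseGas.sideLength ρ N / 2 ^ K < 2 * (1 / Real.sqrt ρ)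 → 1 ≤ k → k ≤ K → ∑ q' : Literature.MathematicalPhysics.QuantumManyBody.BoseGas.SubIdx (2 ^ k), Literature.MathematicalPhysics.QuantumManyBody.BoseGas.occupation N (Literature.MathematicalPhysics.QuantumManyBody.BoseGas.subMode (Literature.MathematicalPhysics.QuantumManyBody.BoseGas.sideLength ρ N / 2 ^ k) q') Ψ.ψ ≤ (∑ q' : Literature.MathematicalPhysics.QuantumManyBody.BoseGas.SubIdx (2 ^ (k - 1)), Literature.MathematicalPhysics.QuantumManyBody.BoseGas.occupation N (Literature.MathematicalPhysics.QuantumManyBody.BoseGas.subMode (Literature.MathematicalPhysics.QuantumManyBody.BoseGas.sideLength ρ N / 2 ^ (k - 1)) q') Ψ.ψ) + ENNReal.ofReal (A * (q ^ (K - k) + q ^ k)) * ∑ q' : Literature.MathematicalPhysics.QuantumManyBody.BoseGas.SubIdx (2 ^ k), Literature.MathematicalPhysics.QuantumManyBody.BoseGas.occupation N (Literature.MathematicalPhysics.QuantumManyBody.BoseGas.subMode (Literature.MathematicalPhysics.QuantumManyBody.BoseGas.sideLength ρ N / 2 ^ k) q') Ψ.ψ) → Literature.MathematicalPhysics.QuantumManyBody.BoseGas.HasGroundStateBEC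 v ρ

-- `CascadeEngine` holds: proved by `Summit.AtomisticToContinuum.BoseEinsteinCondensation.Theorems.HealingPivotCascadeCascadeEngine.cascadeEngine_holds` (its module imports this route file, so no `_holds` link can be stated here).

/-- item stmt-AtomisticToContinuum-32062 · assembly · rank 1 · open · by planner
sources: LSSY2005
[assembly] DiluteFloor → RetentionCap → InfraredDomination → CascadeEngine →
BoseEinsteinCondensation. -/
@[route_item "route-AtomisticToContinuum-HealingPivotCascade"]
def Assembly : Prop :=
  DiluteFloor → RetentionCap → InfraredDomination → CascadeEngine → BoseEinsteinCondensation

/-! D-0027 §2.1 — DECIDING THEOREM (planner-authored via `route open/edit --closes-file`; by planner-decomp-a2c-lens-6-g9-0 2026-08-30T10:14:17Z):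
its hypotheses are this route's items and its conclusion the sub-problem Statement (glue_lint), and it elaborates with this file. -/

@[closes "route-AtomisticToContinuum-HealingPivotCascade"] theorem closes (h₀ : DiluteFloor) (h₁ : RetentionCap) (h₂ : InfraredDomination) (h₃ : CascadeEngine) :
    _root_.BoseEinsteinCondensation := by
  -- ρ₀ := min of the thresholds of the floor (at M = 1), the cap and the domination law; the kernel-proved
  -- engine (support item CascadeEngine) is fed the three eventual statements at each density ρ < ρ₀
  intro v hv
  obtain ⟨ρ₁, hρ₁, H₁⟩ := h₁ v hv
  obtain ⟨ρ₂, hρ₂, H₂⟩ := h₂ v hv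
  obtain ⟨ρ₃, hρ₃, H₃⟩ := h₀ v hv 1 one_pos
  refine ⟨min (min ρ₁ ρ₂) ρ₃, lt_min (lt_min hρ₁ hρ₂) hρ₃, fun ρ hρ hρlt => ?_⟩
  have hlt₁ : ρ < ρ₁ := lt_of_lt_of_le hρlt ((min_le_left _ _).trans (min_le_left _ _))
  have hlt₂ : ρ < ρ₂ := lt_of_lt_of_le hρlt ((min_le_left _ _).trans (min_le_right _ _))
  have hlt₃ : ρ < ρ₃ := lt_of_lt_of_le hρlt (min_le_right _ _)
  exact h₃ v ρ hρ (H₃ ρ hρ hlt₃) (H₁ ρ hρ hlt₁) (H₂ ρ hρ hlt₂)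

end Summit.AtomisticToContinuum.BoseEinsteinCondensation.Theses.HealingPivotCascade
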